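import Summits.QuantumFields.YangMills.Theorems.UnitScaleTiltProp8HalvingSitePackageOfRows
import Summits.QuantumFields.YangMills.Theorems.UnitScaleTiltHalvingP1FlatPillar
import HarnessLib

/-!
# Route `UnitScaleTilt`, crux K1 child «MinimiserStabilityRegPr» (stmt-QuantumFields-19200), registered stub V2′ `stub_halvingStep` (v8∕v10 `BirthV10`) —
# **THE DOOR: THE REGISTERED TEXT OF `BirthV10.stub_halvingStep` (after `∀ L > 1`, verbatim) FROM THE THREE PILLAR TEXTS** — the P2 text `FlatOpsAdmAtMS`
# (hP2), the P1♭ text `P1FlatPillar` (hP1, ✓p619487) and the C_E-end rows (hCE, the displayed shape of ★w8-19200 s2's `ceRows_of_chart`), with the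
# ∃-constants `(R, M, aₑ, S, C′, C₁ = 6, C₂, K₁, K₂, a)` chosen ONCE per odd `L` and the inner radius `ρ` by (163) BEFORE the ceiling `a`
# (LEAD ★w5-19200 g4 09:44:58Z (1), (K-E2E) split with ★w8-19200 s2)

Cell `ym3-torus` (HUMAN RULING D-0037, YM ladder rung R3 — continuum SU(2) YM₃ on the torus is a RUNG, not the Clay problem), width seat `ym-ust-19200-w3` gen 4.
`--supports stmt-QuantumFields-19200 --as helper`; def-free, 0 sorry, standard axioms.  The three pillar texts are HYPOTHESES; nothing here claims the stub,
the crux, the rung or the mass gap.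

WHY.  ✓`HalvingSitePackage.stubText_of_siteRows` asks its per-site rows for EVERY inner radius `ρ ≥ 2` AFTER the constants `(…, a)` are fixed, while the P1♭
pillar's near regime reads `12(ρ + M)ε₁ ≤ 1` — its ceiling `a` and ratio `Cr` see `ρ`.  So the door goes one level down (the eight-line body of
✓`HalvingAssemblyInterior.stubText_of_packageInt_largeRho`): per odd `L > 1` take the P2 constants, the C_E thresholds, choose `M = L^{aₑ}`, `R`, `S = R·M`, take P1♭'s
`B₁(L, S, M)` (ρ-free), the C_E constants `(K₁, K₂, C₂, Cce, a_CE)` (ρ-free), put `C′ := max (max 12 C₂) ((Cce + 2)∕(B₀B₃))`, choose `ρ` by ✓`HalvingAssembly.exists_rho_163`,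
and only THEN the ceiling `a := min a_CE (min (4C′B₀B₃∕(12(ρ+M))) (1∕(60800(5L)²L(B₁+1))))` and `Cr := 4C′B₀B₃`; per member∕site: `P1FlatPillar` ⟹ `P1FlatPillarAt` ⟹
`(u, A)` with its seven conjuncts ⟹ hCE ⟹ the rows ⟹ ✓`sitePackage_of_rows` ⟹ ✓`H_of_packageInt` ⟹ ✓`Prop8LastMile.stubText_of_localCharts167`.  Even `L` is vacuous
(`Idx L` is empty: every `T3Family` has odd `L`).

WHAT THIS FILE PROVES (no definition, no sorry):
* §1 `layerChart_of_memberChart` — the one-point-layer chart identity of the package from P1♭'s member-layer identity (ii) (`x` is the centre of its top cube).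
* §2 ★★★ **`halvingStep_of_rows (hP2) (hP1) (hCE)`** : `∀ L > 1, ∃ B₃ > 4, ∃ a₅ > 0, ∀ i : Idx L, … (famX L i).InU (max (B₃ε₁) (ε₀∕2)) U` — the registered text.
  `hP1` is EXACTLY the output shape of ✓`HalvingP1FlatPillarRows.p1FlatPillar_of_core` (a ρ-uniform `B₁`); `hCE` displays, per odd `L`, P2 data and thresholds,
  then `∀ (R M aₑ S) … (B₁)`, then `∃ (K₁ K₂ C₂ Cce a_CE)`, then per `ρ ≥ 1`, member, heights, `ε`'s, datum, minimiser, site and P1 pair `(u, A)` WITH ITS SEVEN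
  `P1FlatPillarAt` CONJUNCTS: `∃ Hs C e₁ e₃` carrying ✓`sitePackage_of_rows`'s (165)∕(157)∕(160)∕(155) rows VERBATIM and `e₁ ≤ K₁ε₀²`, `e₃ ≤ K₂ε₀²`.
HONEST SCOPE.  Assembly and constants bookkeeping only.  The final door `halvingStep_of_pillars (hP2) (hP1) (hΦ)` is `halvingStep_of_rows hP2 hP1 (ceRows ∘ hΦ)` once
★w8-19200 s2's `ceRows_of_chart` lands (its displayed (Φ-1)∕(Φ-2) become `hΦ`).  NOT a claim about the stub, the crux, the rung or the mass gap.

References: T. Bałaban, CMP **102** (1985) 277–309 [Balaban1985Variational] (152)–(168) pp.301–304, Prop. 8 p.304; CMP **99** (1985) 75–102 [Balaban1985RegularSpaces]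
Thm 2 p.83.
-/

set_option autoImplicit false

noncomputable section

open scoped BigOperators Matrix.Norms.L2Operator

namespace Summit.QuantumFields.YangMills.Theorems.HalvingStepOfPillars

open Literature.MathematicalPhysics.QuantumFieldTheory.Balaban1983to89
open Literature.MathematicalPhysics.QuantumFieldTheory.Balaban1983to89.T3ContinuumYM3Torus
open Literature.MathematicalPhysics.QuantumFieldTheory.Balaban1983to89.T3PrintedRegularMinimiser
open Literature.MathematicalPhysics.QuantumFieldTheory.Balaban1983to89.T3Thm1Carrier
open Complex (I)
open B5Eq117TorusCarriers (Mk)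
open B5Eq118OneStroke (iterBlockOf)
open B5Prop12FieldsLattice (distSite distSite_self)
open B6SectADomainsV1 (Domains)
open B6SectAOperatorsV1 (BondIdx SiteIdx)
open B7Prop1Explicit (expUnit)
open B8Ineq132 (BondTouches)
open B8Eq140Level (SideTouches sideTouches_mono)
open B8Eq143PlaqExpansion (pdiv)
open B8Eq146AExpansion (plaqCovDeriv)
open B8Thm2SetupTorus (pullDom)
open B10Eq27TorusAxialLog (pull unitsField toUField transl)
open LatticeFieldCalculus (bondAvgIter laplace diverg siteAvgIter)
open FlatCubeOpsText (IsLevWeight FlatOpsAdmAtMS)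
open FlatCubeSequenceAligned (cubeSeqMT3)
open FlatOpsLettersAssembly (flatH)
open HalvingQuarterCubeSeq (inOm_top_of_dist)
open HalvingP1FlatPillar (DP1Clause P1FlatPillarAt P1FlatPillar)
open HalvingSitePackage (sitePackage_of_rows)
open Summit.QuantumFields.YangMills.Theorems.Prop8ChartDoubleBar (chartLogFlat)

/-! ## §1 The one-point layer of the package lies in the member's top layer -/

section Layer

variable {F : T3Family} {n K : ℕ}

/-- **THE PACKAGE'S LAYER CHART IDENTITY FROM P1♭'s (ii)**: the one-point layer of `x` at level `K − n` side-touches the member's top domain (`x` is the centre of its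
top cube), so (ii) at `j = K − n` gives the (P1-chart) clause of `H_of_packageInt` verbatim. [cite: Balaban1985Variational, (152) p.301, (144) p.300] -/
theorem layerChart_of_memberChart (hnK : n < K) (x : Site (F.P K) 0) (ρ S M : ℕ) (hM : 1 ≤ M)
    {U : GaugeField (F.P K) 0 (Matrix.specialUnitaryGroup (Fin 2) ℂ)} {u : GaugeTransf (F.P K) 0 (Matrix.unitaryGroup (Fin 2) ℂ)}
    {A : PBond (F.P K) 0 → Matrix (Fin 2) (Fin 2) ℂ}
    (hchart : ∀ j, 1 ≤ j → j ≤ K - n → ∀ (z : B7Prop1Explicit.Site (F.P K).d) (μ : Fin (F.P K).d),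
      SideTouches (pullDom (fun i => {y : Site (F.P K) 0 | (cubeSeqMT3 F n K x ρ S M hM).InOm i y}) j) z μ →
      (Unitary.toUnits (u (transl 0 z)))⁻¹ * unitsField (toUField U) ⟨transl 0 z, μ⟩ * Unitary.toUnits (u ((transl 0 z).shift μ)) =
        expUnit (I • ((((F.L : ℝ)⁻¹) ^ (K - n)) • A ⟨transl 0 z, μ⟩))) :
    ∀ (z : B7Prop1Explicit.Site (F.P K).d) (μ : Fin (F.P K).d),
      SideTouches (pullDom (fun j => if K - n ≤ j then ({x} : Set (Site (F.P K) 0)) else (∅ : Set (Site (F.P K) 0))) (K - n)) z μ →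
      (Unitary.toUnits (u (transl 0 z)))⁻¹ * unitsField (toUField U) ⟨transl 0 z, μ⟩ * Unitary.toUnits (u ((transl 0 z).shift μ)) =
        expUnit (I • ((((F.L : ℝ)⁻¹) ^ (K - n)) • A ⟨transl 0 z, μ⟩)) := by
  have hx : (cubeSeqMT3 F n K x ρ S M hM).InOm (K - n) x := by
    have hd : 0 < (F.P K).d := by rw [T3Family.P_d]; norm_num
    let μ : Fin (F.P K).d := ⟨0, hd⟩
    exact inOm_top_of_dist hnK x ρ S M hM (b := ⟨x, μ⟩) (r₀ := 0) (le_of_eq (distSite_self _)) (Nat.cast_nonneg ρ)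
  have hsub : pullDom (fun j => if K - n ≤ j then ({x} : Set (Site (F.P K) 0)) else (∅ : Set (Site (F.P K) 0))) (K - n) ⊆
      pullDom (fun i => {y : Site (F.P K) 0 | (cubeSeqMT3 F n K x ρ S M hM).InOm i y}) (K - n) := by
    intro z hz
    have hz' : transl (0 : Site (F.P K) 0) z ∈ (if K - n ≤ K - n then ({x} : Set (Site (F.P K) 0)) else (∅ : Set (Site (F.P K) 0))) := hz
    rw [if_pos le_rfl, Set.mem_singleton_iff] at hz'
    show (cubeSeqMT3 F n K x ρ S M hM).InOm (K - n) (transl (0 : Site (F.P K) 0) z)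
    rw [hz']
    exact hx
  exact fun z μ hz => hchart (K - n) (by omega) le_rfl z μ (sideTouches_mono hsub hz)

end Layer

/-! ## §2 The door -/

section Door

/-- ★★★ **THE DOOR: THE REGISTERED TEXT OF `BirthV10.stub_halvingStep` FROM THE THREE PILLAR TEXTS** (see the module docstring for the order of the constants).
[cite: Balaban1985Variational, (152)-(168) pp.301-304, Prop. 8 p.304; Balaban1985RegularSpaces, Thm 2 p.83] -/
theorem halvingStep_of_rows
    (hP2 : ∀ L : ℕ, Odd L → 1 < L → ∃ (R₀ M₀ : ℕ) (B₀ δ₀ B₃ : ℝ), 0 < B₀ ∧ 0 < δ₀ ∧ 0 < B₃ ∧ FlatOpsAdmAtMS L R₀ M₀ B₀ δ₀ B₃)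
    (hP1 : ∀ L : ℕ, Odd L → 1 < L → ∀ (S M : ℕ) (hM : 1 ≤ M), ∃ B₁ : ℝ, 0 ≤ B₁ ∧
      ∀ (ρ : ℕ) (a Cr : ℝ), 0 < Cr → 12 * ((ρ : ℝ) + (M : ℝ)) * a ≤ Cr →
        16 * 3800 * ((5 * L : ℕ) : ℝ) ^ 2 * (L : ℝ) * ((B₁ + 1) * a) ≤ 1 → P1FlatPillar L ρ S M hM a Cr B₁ 6 (8 * (L : ℝ) * (B₁ + 1)))
    (hCE : ∀ L : ℕ, Odd L → 1 < L → ∀ (R₀ M₀ : ℕ) (B₀ δ₀ B₃ : ℝ), 0 < B₀ → 0 < δ₀ → 0 < B₃ → FlatOpsAdmAtMS L R₀ M₀ B₀ δ₀ B₃ →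
      ∃ (M₁ R₁ : ℕ), ∀ (R M aₑ S : ℕ) (hM : 1 ≤ M), M = L ^ aₑ → M₁ ≤ M → M₀ ≤ M → R₁ ≤ R → R₀ ≤ R → R * M ≤ S →
      ∀ B₁ : ℝ, 0 ≤ B₁ →
      ∃ (K₁ K₂ C₂ Cce aCE : ℝ), 0 ≤ K₁ ∧ 0 ≤ K₂ ∧ 0 ≤ C₂ ∧ 0 ≤ Cce ∧ 0 < aCE ∧
      ∀ ρ : ℕ, 1 ≤ ρ → ∀ F : T3Family, F.L = L → ∀ (n K : ℕ) (hnK : n < K) (ε₀ ε₁ : ℝ), 0 < ε₁ → 0 < ε₀ → ε₀ ≤ aCE → Cce * ε₁ ≤ ε₀ →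
        ∀ V : GaugeField (F.P n) 0 (Matrix.specialUnitaryGroup (Fin 2) ℂ), PlaqSmall ε₁ V →
          ∀ U ∈ regFibrePr F n K hnK.le ε₀ V,
            IsMinOn (fun W : GaugeField (F.P K) 0 (Matrix.specialUnitaryGroup (Fin 2) ℂ) => wilsonAction4 W) (regFibrePr F n K hnK.le ε₀ V) U →
            ∀ (x : Site (F.P K) 0) (C₂' : ℝ) (u : GaugeTransf (F.P K) 0 (Matrix.unitaryGroup (Fin 2) ℂ)) (A : PBond (F.P K) 0 → Matrix (Fin 2) (Fin 2) ℂ),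
              -- the seven conjuncts of `P1FlatPillarAt F n K (cubeSeqMT3 F n K x ρ S M hM) x ε₀ ε₁ B₁ 6 C₂' U` for THIS pair `(u, A)`
              DP1Clause F n K (cubeSeqMT3 F n K x ρ S M hM) x U u →
              (∀ b : PBond (F.P K) 0, IsSelfAdjoint (A b)) → (∀ b : PBond (F.P K) 0, Matrix.trace (A b) = 0) →
              (∀ j, 1 ≤ j → j ≤ K - n → ∀ (z : B7Prop1Explicit.Site (F.P K).d) (μ : Fin (F.P K).d),
                SideTouches (pullDom (fun i => {y : Site (F.P K) 0 | (cubeSeqMT3 F n K x ρ S M hM).InOm i y}) j) z μ →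
                (Unitary.toUnits (u (transl 0 z)))⁻¹ * unitsField (toUField U) ⟨transl 0 z, μ⟩ * Unitary.toUnits (u ((transl 0 z).shift μ)) =
                  expUnit (I • ((((F.L : ℝ)⁻¹) ^ (K - n)) • A ⟨transl 0 z, μ⟩))) →
              (∀ w : ℕ → PBond (F.P K) 0 → ℝ, IsLevWeight F n K (cubeSeqMT3 F n K x ρ S M hM) w →
                (∀ b : PBond (F.P K) 0, w 1 b * ‖A b‖ ≤ B₁ * ε₀) ∧
                (∀ (b : PBond (F.P K) 0) (ν : Fin (F.P K).d), w 2 b * (F.L : ℝ) ^ (K - n) * ‖A ⟨b.src.shift ν, b.dir⟩ - A b‖ ≤ B₁ * ε₀)) →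
              (∃ μ : SiteIdx (cubeSeqMT3 F n K x ρ S M hM) → Matrix (Fin 2) (Fin 2) ℂ, ∀ s : Site (F.P K) 0,
                laplace ((F.L : ℝ) ^ (K - n)) (diverg ((F.L : ℝ) ^ (K - n)) A) s =
                  ∑ i : SiteIdx (cubeSeqMT3 F n K x ρ S M hM), siteAvgIter (i.1.1 : ℕ) (Pi.single s (1 : ℝ)) i.1.2 • μ i) →
              (∀ c : BondIdx (cubeSeqMT3 F n K x ρ S M hM), (c.1.1 : ℕ) = K - n →
                c.1.2.src ∈ (cubeSeqMT3 F n K x ρ S M hM).Om (c.1.1 : ℕ) → c.1.2.tgt ∈ (cubeSeqMT3 F n K x ρ S M hM).Om (c.1.1 : ℕ) →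
                ‖chartLogFlat (((F.L : ℝ)⁻¹) ^ (K - n)) (cubeSeqMT3 F n K x ρ S M hM) A c‖ ≤
                  6 * ε₁ * (distSite (Mk (F.P K) (c.1.1 : ℕ)) c.1.2.src (iterBlockOf (c.1.1 : ℕ) x) + 1)) →
              (∀ c : BondIdx (cubeSeqMT3 F n K x ρ S M hM), ‖chartLogFlat (((F.L : ℝ)⁻¹) ^ (K - n)) (cubeSeqMT3 F n K x ρ S M hM) A c‖ ≤ C₂' * ε₀) →
              -- OUTPUT: `sitePackage_of_rows`'s rows for some `Hs`, `C`, `e₁`, `e₃`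
              ∃ (Hs : (BondIdx (cubeSeqMT3 F n K x ρ S M hM) → Matrix (Fin 2) (Fin 2) ℂ) → (PBond (F.P K) 0 → Matrix (Fin 2) (Fin 2) ℂ))
                (C : (PBond (F.P K) 0 → Matrix (Fin 2) (Fin 2) ℂ) → (BondIdx (cubeSeqMT3 F n K x ρ S M hM) → Matrix (Fin 2) (Fin 2) ℂ))
                (e₁ e₃ : ℝ),
                ((∀ (z : B7Prop1Explicit.Site (F.P K).d) (τ : Fin (F.P K).d),
                    SideTouches (pullDom (fun j => if K - n ≤ j then ({x} : Set (Site (F.P K) 0)) else (∅ : Set (Site (F.P K) 0))) (K - n)) z τ →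
                    ‖((A + Hs (C A)) - fun b : PBond (F.P K) 0 => ∑ c, flatH F n K (cubeSeqMT3 F n K x ρ S M hM) (Pi.single c 1) b •
                        bondAvgIter (c.1.1 : ℕ) (A + Hs (C A)) c.1.2) ⟨transl 0 z, τ⟩‖ ≤ e₁) ∧
                  (∀ (z : B7Prop1Explicit.Site (F.P K).d) (κ τ : Fin (F.P K).d),
                    SideTouches (pullDom (fun j => if K - n ≤ j then ({x} : Set (Site (F.P K) 0)) else (∅ : Set (Site (F.P K) 0))) (K - n)) z τ →
                    ‖(((F.L : ℝ)⁻¹) ^ (K - n))⁻¹ •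
                      (((A + Hs (C A)) - fun b : PBond (F.P K) 0 => ∑ c, flatH F n K (cubeSeqMT3 F n K x ρ S M hM) (Pi.single c 1) b •
                          bondAvgIter (c.1.1 : ℕ) (A + Hs (C A)) c.1.2) ⟨(transl 0 z).shift κ, τ⟩ -
                        ((A + Hs (C A)) - fun b : PBond (F.P K) 0 => ∑ c, flatH F n K (cubeSeqMT3 F n K x ρ S M hM) (Pi.single c 1) b •
                          bondAvgIter (c.1.1 : ℕ) (A + Hs (C A)) c.1.2) ⟨transl 0 z, τ⟩)‖ ≤ e₁) ∧
                  (∀ (z : B7Prop1Explicit.Site (F.P K).d) (μ : Fin (F.P K).d),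
                    BondTouches (pullDom (fun j => if K - n ≤ j then ({x} : Set (Site (F.P K) 0)) else (∅ : Set (Site (F.P K) 0))) (K - n)) z μ →
                    ‖pdiv (((F.L : ℝ)⁻¹) ^ (K - n)) (1 : B7Prop1Explicit.Site (F.P K).d → Fin (F.P K).d → (Matrix (Fin 2) (Fin 2) ℂ)ˣ)
                        (plaqCovDeriv (((F.L : ℝ)⁻¹) ^ (K - n)) (1 : B7Prop1Explicit.Site (F.P K).d → Fin (F.P K).d → (Matrix (Fin 2) (Fin 2) ℂ)ˣ)
                          (pull ((A + Hs (C A)) - fun b : PBond (F.P K) 0 => ∑ c, flatH F n K (cubeSeqMT3 F n K x ρ S M hM) (Pi.single c 1) b •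
                            bondAvgIter (c.1.1 : ℕ) (A + Hs (C A)) c.1.2) 0)) μ z‖ ≤ e₁)) ∧
                ((∀ (z : B7Prop1Explicit.Site (F.P K).d) (τ : Fin (F.P K).d),
                    SideTouches (pullDom (fun j => if K - n ≤ j then ({x} : Set (Site (F.P K) 0)) else (∅ : Set (Site (F.P K) 0))) (K - n)) z τ →
                    ‖Hs (C A) ⟨transl 0 z, τ⟩‖ ≤ e₃) ∧
                  (∀ (z : B7Prop1Explicit.Site (F.P K).d) (κ τ : Fin (F.P K).d),
                    SideTouches (pullDom (fun j => if K - n ≤ j then ({x} : Set (Site (F.P K) 0)) else (∅ : Set (Site (F.P K) 0))) (K - n)) z τ →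
                    ‖(((F.L : ℝ)⁻¹) ^ (K - n))⁻¹ • (Hs (C A) ⟨(transl 0 z).shift κ, τ⟩ - Hs (C A) ⟨transl 0 z, τ⟩)‖ ≤ e₃) ∧
                  (∀ (z : B7Prop1Explicit.Site (F.P K).d) (μ : Fin (F.P K).d),
                    BondTouches (pullDom (fun j => if K - n ≤ j then ({x} : Set (Site (F.P K) 0)) else (∅ : Set (Site (F.P K) 0))) (K - n)) z μ →
                    ‖pdiv (((F.L : ℝ)⁻¹) ^ (K - n)) (1 : B7Prop1Explicit.Site (F.P K).d → Fin (F.P K).d → (Matrix (Fin 2) (Fin 2) ℂ)ˣ)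
                        (plaqCovDeriv (((F.L : ℝ)⁻¹) ^ (K - n)) (1 : B7Prop1Explicit.Site (F.P K).d → Fin (F.P K).d → (Matrix (Fin 2) (Fin 2) ℂ)ˣ)
                          (pull (Hs (C A)) 0)) μ z‖ ≤ e₃)) ∧
                (∀ c : BondIdx (cubeSeqMT3 F n K x ρ S M hM), (c.1.1 : ℕ) = K - n →
                  c.1.2.src ∈ (cubeSeqMT3 F n K x ρ S M hM).Om (c.1.1 : ℕ) → c.1.2.tgt ∈ (cubeSeqMT3 F n K x ρ S M hM).Om (c.1.1 : ℕ) →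
                  ‖bondAvgIter (c.1.1 : ℕ) (A + Hs (C A)) c.1.2‖ ≤ 6 * ε₁ * (distSite (Mk (F.P K) (c.1.1 : ℕ)) c.1.2.src (iterBlockOf (c.1.1 : ℕ) x) + 1)) ∧
                (∀ c : BondIdx (cubeSeqMT3 F n K x ρ S M hM),
                  ¬ ((c.1.1 : ℕ) = K - n ∧ c.1.2.src ∈ (cubeSeqMT3 F n K x ρ S M hM).Om (c.1.1 : ℕ) ∧
                      c.1.2.tgt ∈ (cubeSeqMT3 F n K x ρ S M hM).Om (c.1.1 : ℕ)) →
                  ‖bondAvgIter (c.1.1 : ℕ) (A + Hs (C A)) c.1.2‖ ≤ C₂ * ε₀ * (F.L : ℝ) ^ ((K - n) - (c.1.1 : ℕ))) ∧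
                e₁ ≤ K₁ * ε₀ ^ 2 ∧ e₃ ≤ K₂ * ε₀ ^ 2) :
    ∀ (L : ℕ), 1 < L → ∃ B₃ : ℝ, 4 < B₃ ∧ ∃ a₅ : ℝ, 0 < a₅ ∧
      ∀ (i : Idx L) (ε₀ ε₁ : ℝ), 0 < ε₁ → ∀ (V : (famX L i).Bdry) (U : (famX L i).Cfg), (famX L i).Reg7 ε₁ V → (famX L i).InU ε₀ U →
        (famX L i).InB V U → (famX L i).IsCritical V U → ε₀ ≤ a₅ → (famX L i).InU (max (B₃ * ε₁) (ε₀ / 2)) U := by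
  refine Prop8LastMile.stubText_of_localCharts167 fun L hL => ?_
  by_cases hodd : Odd L
  swap
  · -- even `L`: no member, the schema is vacuous
    refine ⟨5, by norm_num, 0, le_rfl, 1, one_pos, fun F hF => ?_⟩
    exact absurd (hF ▸ F.hL.1) hodd
  -- the P2 text and its constants
  obtain ⟨R₀, M₀, B₀, δ₀, B₃, hB₀, hδ₀, hB₃, hP2L⟩ := hP2 L hodd hL
  -- the C_E thresholds
  obtain ⟨M₁, R₁, hCE₁⟩ := hCE L hodd hL R₀ M₀ B₀ δ₀ B₃ hB₀ hδ₀ hB₃ hP2L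
  -- the geometry of the cube sequence: `M = L^{aₑ} ≥ max M₁ M₀`, `R = max R₁ R₀`, `S = R·M`
  set aₑ : ℕ := max M₁ M₀ with haₑ
  set M : ℕ := L ^ aₑ with hMdef
  have hL2 : 2 ≤ L := hL
  have hpow : aₑ ≤ L ^ aₑ := (Nat.lt_pow_self (by omega)).le
  have hM₁M : M₁ ≤ M := (le_max_left _ _).trans hpow
  have hM₀M : M₀ ≤ M := (le_max_right _ _).trans hpow
  have hM1 : 1 ≤ M := Nat.one_le_pow _ _ (by omega)
  set R : ℕ := max R₁ R₀ with hRdef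
  set S : ℕ := R * M with hSdef
  -- P1♭'s size constant (ρ-free)
  obtain ⟨B₁, hB₁, hP1L⟩ := hP1 L hodd hL S M hM1
  -- the C_E constants (ρ-free)
  obtain ⟨K₁, K₂, C₂, Cce, aCE, hK₁, hK₂, hC₂, hCce, haCE, hCE₂⟩ :=
    hCE₁ R M aₑ S hM1 rfl hM₁M hM₀M (le_max_left _ _) (le_max_right _ _) le_rfl B₁ hB₁
  -- the package constant `C′` and the inner radius `ρ` by (163)
  have hBB : 0 < B₀ * B₃ := mul_pos hB₀ hB₃
  set C' : ℝ := max (max 12 C₂) ((Cce + 2) / (B₀ * B₃)) with hC'def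
  have hC'12 : (12 : ℝ) ≤ C' := (le_max_left _ _).trans (le_max_left _ _)
  have hC'C₂ : C₂ ≤ C' := (le_max_right _ _).trans (le_max_left _ _)
  have hC'ce : (Cce + 2) / (B₀ * B₃) ≤ C' := le_max_right _ _
  have hC'0 : 0 ≤ C' := by linarith
  have hCBB : Cce + 2 ≤ C' * (B₀ * B₃) := by
    have := (div_le_iff₀ hBB).1 hC'ce
    linarith
  have hT0 : 0 ≤ 4 * C' * B₀ * B₃ := by positivity
  obtain ⟨ρ, hρ2, h163⟩ := HalvingAssembly.exists_rho_163 hδ₀ hT0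
  have hρ1 : 1 ≤ ρ := by
    have : (1 : ℝ) ≤ (ρ : ℝ) := by linarith
    exact_mod_cast this
  -- the ceiling `a` (after `ρ`) and the ratio `Cr`
  set Cr : ℝ := 4 * C' * B₀ * B₃ with hCrdef
  have hCr : 0 < Cr := by
    have : (2 : ℝ) ≤ C' * (B₀ * B₃) := by linarith
    rw [hCrdef]; nlinarith
  have hρM : 0 < 12 * ((ρ : ℝ) + (M : ℝ)) := by positivity
  have hden : 0 < 16 * 3800 * ((5 * L : ℕ) : ℝ) ^ 2 * (L : ℝ) * (B₁ + 1) := by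
    have : (0 : ℝ) < L := by exact_mod_cast (by omega : 0 < L)
    have : (0 : ℝ) < ((5 * L : ℕ) : ℝ) := by positivity
    positivity
  set a : ℝ := min aCE (min (Cr / (12 * ((ρ : ℝ) + (M : ℝ)))) (1 / (16 * 3800 * ((5 * L : ℕ) : ℝ) ^ 2 * (L : ℝ) * (B₁ + 1))))
    with hadef
  have ha : 0 < a := lt_min haCE (lt_min (div_pos hCr hρM) (div_pos one_pos hden))
  have haCE' : a ≤ aCE := min_le_left _ _
  have hreg₁ : 12 * ((ρ : ℝ) + (M : ℝ)) * a ≤ Cr := by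
    have h1 : a ≤ Cr / (12 * ((ρ : ℝ) + (M : ℝ))) := (min_le_right _ _).trans (min_le_left _ _)
    have := (le_div_iff₀ hρM).1 h1
    linarith
  have hreg₀ : 16 * 3800 * ((5 * L : ℕ) : ℝ) ^ 2 * (L : ℝ) * ((B₁ + 1) * a) ≤ 1 := by
    have h1 : a ≤ 1 / (16 * 3800 * ((5 * L : ℕ) : ℝ) ^ 2 * (L : ℝ) * (B₁ + 1)) := (min_le_right _ _).trans (min_le_right _ _)
    have := (le_div_iff₀ hden).1 h1
    linarith
  -- P1♭ at these constants
  have hP1' := hP1L ρ a Cr hCr hreg₁ hreg₀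
  -- the schema: `H(L, 4C′B₀B₃, K₁ + K₂ + 1, a)`
  refine ⟨4 * C' * B₀ * B₃, by nlinarith, K₁ + K₂ + 1, by positivity, a, ha, ?_⟩
  have hR₀R : R₀ ≤ R := le_max_right R₁ R₀
  have hRS : R * M ≤ S := le_rfl
  refine HalvingAssemblyInterior.H_of_packageInt hP2L hB₀.le hδ₀.le hB₃.le (R := R) (M := M) (aₑ := aₑ) (ρ := ρ) (S := S) hR₀R hM₀M rfl hM1
    hRS hρ2 (C := C') (C₁ := 6) (C₂ := C₂) (K₁ := K₁) (K₂ := K₂) (a := a) (by norm_num) (by linarith) hC'C₂ h163 ?_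
  intro F hF n K hnK ε₀ ε₁ hε₁ hε₀ hε₀a hreg V hV U hU hmin x
  -- P1♭ at the member and the site
  have hCrε : Cr * ε₁ ≤ ε₀ := by rw [hCrdef]; exact hreg.le
  have hAt := hP1' F hF n K hnK ε₀ ε₁ hε₁ hε₀ hε₀a hCrε V hV U hU x
  obtain ⟨u, A, ho, hsa, htr, hii, hiii, hiv, hvi, hvii⟩ := hAt
  -- the C_E rows
  have hCceε : Cce * ε₁ ≤ ε₀ := by
    have h1 : Cce ≤ Cr := by rw [hCrdef]; nlinarith
    nlinarith
  obtain ⟨Hs, C, e₁, e₃, h165, h157, hnear, hfar, he₁, he₃⟩ :=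
    hCE₂ ρ hρ1 F hF n K hnK ε₀ ε₁ hε₁ hε₀ (hε₀a.trans haCE') hCceε V hV U hU hmin x _ u A ho hsa htr hii hiii hiv hvi hvii
  exact sitePackage_of_rows x ρ S M hM1 U u A Hs C hsa (layerChart_of_memberChart hnK x ρ S M hM1 hii) h165 h157 hnear hfar he₁ he₃

end Door

end Summit.QuantumFields.YangMills.Theorems.HalvingStepOfPillars


/-! ## §3 Weak-sign P2 text: monotonicity in `B₀` and the door with `0 ≤ B₀` (v1.1, append-only) -/

namespace Summit.QuantumFields.YangMills.Theorems.HalvingStepOfPillars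

open Literature.MathematicalPhysics.QuantumFieldTheory.Balaban1983to89
open Literature.MathematicalPhysics.QuantumFieldTheory.Balaban1983to89.T3ContinuumYM3Torus
open Literature.MathematicalPhysics.QuantumFieldTheory.Balaban1983to89.T3PrintedRegularMinimiser
open Literature.MathematicalPhysics.QuantumFieldTheory.Balaban1983to89.T3Thm1Carrier
open Complex (I)
open B5Eq117TorusCarriers (Mk)
open B5Eq118OneStroke (iterBlockOf)
open B5Prop12FieldsLattice (distSite)
open B6SectADomainsV1 (Domains)
open B6SectAOperatorsV1 (BondIdx SiteIdx)
open B7Prop1Explicit (expUnit)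
open B8Ineq132 (BondTouches)
open B8Eq140Level (SideTouches)
open B8Eq143PlaqExpansion (pdiv)
open B8Eq146AExpansion (plaqCovDeriv)
open B8Thm2SetupTorus (pullDom)
open B10Eq27TorusAxialLog (pull unitsField toUField transl)
open LatticeFieldCalculus (bondAvgIter laplace diverg siteAvgIter)
open FlatCubeOpsText (IsLevWeight FlatOpsAdmAtMS HSupLetterG GtSupLetterG GtLaplaceLetterG HDecayLetterD RowSum162)
open FlatCubeSequenceAligned (cubeSeqMT3)
open FlatOpsLettersAssembly (flatH)
open HalvingP1FlatPillar (DP1Clause P1FlatPillarAt P1FlatPillar)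
open Summit.QuantumFields.YangMills.Theorems.Prop8ChartDoubleBar (chartLogFlat)

section Mono

/-- **THE P2 TEXT IS MONOTONE IN `B₀`**: every letter of `FlatOpsAdmAtMS` bounds a nonnegative quantity by `B₀` times a nonnegative one, so the text with `B₀` implies
the text with any `B₀′ ≥ B₀` (used to make `B₀` strictly positive at the door). [cite: Balaban1985Variational, (157) p.302, (162) p.303] -/
theorem flatOpsAdmAtMS_mono {L R₀ M₀ : ℕ} {B₀ B₀' δ₀ B₃ : ℝ} (hle : B₀ ≤ B₀') (h : FlatOpsAdmAtMS L R₀ M₀ B₀ δ₀ B₃) :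
    FlatOpsAdmAtMS L R₀ M₀ B₀' δ₀ B₃ := by
  intro F hF n K hnK R M hR hM hMa D hDk hAdm w hw
  obtain ⟨H, Gt, hH, hGt, hsup, hgsup, hglap, dBI, hdom, h162, hdec⟩ := h F hF n K hnK R M hR hM hMa D hDk hAdm w hw
  refine ⟨H, Gt, hH, hGt, ?_, ?_, ?_, dBI, hdom, h162, ?_⟩
  · intro X t ht hX
    obtain ⟨h1, h2⟩ := hsup X t ht hX
    have hm : B₀ * t ≤ B₀' * t := mul_le_mul_of_nonneg_right hle ht
    exact ⟨fun b => (h1 b).trans hm, fun b ν => (h2 b ν).trans hm⟩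
  · intro f β hβ hf
    obtain ⟨h1, h2⟩ := hgsup f β hβ hf
    have hm : B₀ * β ≤ B₀' * β := mul_le_mul_of_nonneg_right hle hβ
    exact ⟨fun b => (h1 b).trans hm, fun b ν => (h2 b ν).trans hm⟩
  · intro f β hβ hf b
    have hm : B₀ * β ≤ B₀' * β := mul_le_mul_of_nonneg_right hle hβ
    exact (hglap f β hβ hf b).trans hm
  · intro X b
    obtain ⟨h1, h2, h3, h4⟩ := hdec X b
    have hS : 0 ≤ ∑ c, Real.exp (-(δ₀ * dBI b c)) * |X c| :=
      Finset.sum_nonneg fun c _ => mul_nonneg (Real.exp_pos _).le (abs_nonneg _)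
    have hm : B₀ * ∑ c, Real.exp (-(δ₀ * dBI b c)) * |X c| ≤ B₀' * ∑ c, Real.exp (-(δ₀ * dBI b c)) * |X c| :=
      mul_le_mul_of_nonneg_right hle hS
    exact ⟨h1.trans hm, fun ν => (h2 ν).trans hm, h3.trans hm, h4.trans hm⟩

end Mono

end Summit.QuantumFields.YangMills.Theorems.HalvingStepOfPillars


/-! ## §4 The P2 binder of the door from a weak-sign exporter (v1.2, append-only) -/

namespace Summit.QuantumFields.YangMills.Theorems.HalvingStepOfPillars

open FlatCubeOpsText (FlatOpsAdmAtMS)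

/-- **THE DOOR'S P2 BINDER FROM A WEAK-SIGN EXPORTER**: `0 ≤ B₀` (as ✓`flatOpsAdmAtMS_of_kernelRows` ∕ `body_of_adm22_allL` export it) upgrades to the door's
`0 < B₀` by `B₀ ↦ B₀ + 1` (`flatOpsAdmAtMS_mono`). [cite: Balaban1985Variational, (157) p.302, (162) p.303] -/
theorem hP2_pos_of_nonneg
    (hP2 : ∀ L : ℕ, Odd L → 1 < L → ∃ (R₀ M₀ : ℕ) (B₀ δ₀ B₃ : ℝ), 0 ≤ B₀ ∧ 0 < δ₀ ∧ 0 < B₃ ∧ FlatOpsAdmAtMS L R₀ M₀ B₀ δ₀ B₃) :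
    ∀ L : ℕ, Odd L → 1 < L → ∃ (R₀ M₀ : ℕ) (B₀ δ₀ B₃ : ℝ), 0 < B₀ ∧ 0 < δ₀ ∧ 0 < B₃ ∧ FlatOpsAdmAtMS L R₀ M₀ B₀ δ₀ B₃ := by
  intro L hodd hL
  obtain ⟨R₀, M₀, B₀, δ₀, B₃, hB₀, hδ₀, hB₃, h⟩ := hP2 L hodd hL
  exact ⟨R₀, M₀, B₀ + 1, δ₀, B₃, by linarith, hδ₀, hB₃, flatOpsAdmAtMS_mono (by linarith) h⟩

end Summit.QuantumFields.YangMills.Theorems.HalvingStepOfPillars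

end
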